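import Literature.AlgebraicGeometry.Motives.MixedHodgeStructureCompositionMultiplicity
import Mathlib.Algebra.BigOperators.Finprod
import Mathlib.Order.Interval.Finset.SuccPred
import Mathlib.Algebra.Order.SuccPred
import HarnessLib

/-!
# Multiplicity formulas for mixed Hodge structures: `[H : S] = [Gr^W_m H : S]`

Sequel to `MixedHodgeStructureCompositionMultiplicity` (the Jordan–Hölder multiplicity
`[H : S] = H.multiplicity S`, additive on `0 → R → H → H/R → 0` and invariant under isomorphisms).
Beachy, *Introductory Lectures on Rings and Modules*, §2.5, Def. 2.5.1 / Thm. 2.5.2 (Jordan–Hölder: the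
number of composition factors isomorphic to a given simple is an invariant); Cattani–El Zein–Griffiths–Lê,
*Hodge Theory*, Def. 3.2.15 (weight filtration, `Gr^W_k` pure of weight `k`), Thm. 3.2.18 (abelian category),
Ex. 3.2.23 (1) (pure MHS), p. 270 (simple / semisimple MHS).

* §1 purity is inherited by sub-MHS, quotients, subquotients and isomorphic MHS (`IsPure.subMixedHodgeStructure`,
  `IsPure.quotient`, `IsPure.of_bijective`, `SubquotientIsoTo.isPure`).
* §2 **multiplicities along the weight filtration**: a pure MHS has no composition factor of another weight
  (`IsPure.multiplicity_eq_zero_of_ne`); `[W_k H : S] = [W_{k-1} H : S] + [Gr^W_k H : S]`;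
  **`[H : S] = Σ_k [Gr^W_k H : S]`** (`multiplicity_eq_sum_multiplicity_gr`, `multiplicity_eq_finsum_multiplicity_gr`);
  **`[H : S] = [Gr^W_m H : S]` for `S` pure of weight `m`** (`multiplicity_eq_multiplicity_gr`; every simple `S` is
  pure of some weight, `IsSimple.exists_multiplicity_eq_multiplicity_gr`); the weight of a composition factor is a
  weight of `H` (`isWeight_of_multiplicity_pos`).
* §3 **direct sums and exact sequences**: `[S ⊔ T : X] = [S : X] + [T : X]` for `S ∩ T = 0`, complements,
  independent families (`multiplicity_biSup_of_iSupIndep`, `multiplicity_eq_sum_of_iSupIndep_of_iSup_eq_top`),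
  **for a decomposition into simple sub-MHS `[H : S]` is the number of summands `≅ S`**
  (`multiplicity_eq_card_filter_of_isSimple` — the Jordan–Hölder count agrees with the Krull–Schmidt count),
  `[H₁ ⊕ H₂ : S] = [H₁ : S] + [H₂ : S]` (`multiplicity_prod`), rank–nullity
  `[Ker f : S] + [Im f : S] = [H : S]`, short exact sequences and extensions (`multiplicity_eq_add_of_exact`,
  `Extension.multiplicity_eq`).

All statements proved; no definitions, no named facts, no instances.

## References

* [Beachy1999RingsModules] J. A. Beachy, Introductory Lectures on Rings and Modules (1999), §2.5, Def. 2.5.1,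
  Thm. 2.5.2 (held text `book:beachy1999-introductory-lectures-rings-modules`, chunks p0098–p0099).
* [CattaniElZeinGriffithsLe2014] E. Cattani et al. (eds.), Hodge Theory (2014), Def. 3.2.15, Thm. 3.2.18,
  Lemma 3.2.20, Ex. 3.2.23 (1), p. 270.
-/

noncomputable section

namespace Literature.AlgebraicGeometry.Motives

namespace MixedHodgeStructure

universe u v w

variable {V : Type u} [AddCommGroup V] [Module ℚ V]
variable {V' : Type v} [AddCommGroup V'] [Module ℚ V']
variable {U : Type w} [AddCommGroup U] [Module ℚ U]
variable {H : MixedHodgeStructure V} {H' : MixedHodgeStructure V'} {S : MixedHodgeStructure U}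

open SubMixedHodgeStructure

/-! ### §1 Purity is inherited by sub-objects, quotients, subquotients and isomorphic objects -/

/-- **A sub-MHS of a pure MHS of weight `n` is pure of weight `n`** (induced filtration).
[cite: CattaniElZeinGriffithsLe2014, Ex. 3.2.23 (1) and Lemma 3.2.20] -/
theorem IsPure.subMixedHodgeStructure {n : ℤ} (h : H.IsPure n) (T : SubMixedHodgeStructure H) :
    T.toMixedHodgeStructure.IsPure n := by
  refine ⟨fun k hk => ?_, fun k hk => ?_⟩
  · show (H.W k).comap T.toSubmodule.subtype = ⊥
    rw [h.1 k hk, Submodule.comap_bot]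
    exact Submodule.ker_subtype _
  · show (H.W k).comap T.toSubmodule.subtype = ⊤
    rw [h.2 k hk, Submodule.comap_top]

/-- **A quotient of a pure MHS of weight `n` is pure of weight `n`** (quotient filtration).
[cite: CattaniElZeinGriffithsLe2014, Ex. 3.2.23 (1) and Lemma 3.2.20] -/
theorem IsPure.quotient {n : ℤ} (h : H.IsPure n) (T : SubMixedHodgeStructure H) : T.quotient.IsPure n := by
  refine ⟨fun k hk => ?_, fun k hk => ?_⟩
  · rw [quotient_W, h.1 k hk, Submodule.map_bot]
  · rw [quotient_W, h.2 k hk, Submodule.map_top, Submodule.range_mkQ]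

/-- **Purity is invariant under isomorphisms of MHS** (morphisms respect `W`, and so does the inverse).
[cite: CattaniElZeinGriffithsLe2014, Ex. 3.2.23 (1) and Thm. 3.2.18] -/
theorem IsPure.of_bijective {n : ℤ} (h : H.IsPure n) (f : Hom H H') (hf : Function.Bijective f.toLinearMap) :
    H'.IsPure n := by
  refine ⟨fun k hk => ?_, fun k hk => ?_⟩
  · -- `f⁻¹(W'_k) ⊆ W_k = 0`, and `f⁻¹` is injective
    have hg := (f.inverse hf).map_W_le k
    rw [h.1 k hk, le_bot_iff] at hg
    have hinj : Function.Injective (f.inverse hf).toLinearMap := by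
      rw [Hom.inverse_toLinearMap]
      exact (LinearEquiv.ofBijective f.toLinearMap hf).symm.injective
    rw [eq_bot_iff]
    intro x hx
    have hx0 : (f.inverse hf).toLinearMap x ∈ (⊥ : Submodule ℚ V) := hg ▸ Submodule.mem_map_of_mem hx
    rw [Submodule.mem_bot] at hx0 ⊢
    exact hinj (by rw [hx0, map_zero])
  · have hle := f.map_W_le k
    rw [h.2 k hk, Submodule.map_top, LinearMap.range_eq_top.2 hf.2] at hle
    exact eq_top_iff.2 hle

/-- A subquotient of a pure MHS of weight `n` is pure of weight `n`; hence so is anything isomorphic to it.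
[cite: CattaniElZeinGriffithsLe2014, Ex. 3.2.23 (1)] -/
theorem SubMixedHodgeStructure.SubquotientIsoTo.isPure {n : ℤ} (hH : H.IsPure n) {A B : SubMixedHodgeStructure H}
    (h : SubquotientIsoTo A B S) : S.IsPure n := by
  obtain ⟨e, he⟩ := h
  exact ((hH.subMixedHodgeStructure B).quotient (A.comap B.subtype)).of_bijective e he

/-! ### §2 Multiplicities in pure MHS and in the graded pieces -/

/-- **A pure MHS of weight `n` has no composition factor of another weight**: `[H : S] = 0` for `S` pure of
weight `m ≠ n` (on a non-zero space). [cite: Beachy1999RingsModules, §2.5, Def. 2.5.1] [cite: CattaniElZeinGriffithsLe2014, Ex. 3.2.23 (1)] -/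
theorem IsPure.multiplicity_eq_zero_of_ne [FiniteDimensional ℚ V] [Nontrivial U] {n m : ℤ} (hH : H.IsPure n)
    (hS : S.IsPure m) (hnm : n ≠ m) : H.multiplicity S = 0 := by
  classical
  obtain ⟨t, h₁, h₂⟩ := exists_compositionSeries H
  rw [← t.count_eq_multiplicity h₁ h₂, CompositionSeries.count_eq]
  refine Finset.sum_eq_zero fun i _ => ?_
  rw [if_neg]
  intro hi
  exact hnm ((hi.isPure hH).unique hS)

/-- The multiplicity in a zero MHS vanishes. [cite: Beachy1999RingsModules, §2.5, Def. 2.5.1] -/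
theorem multiplicity_eq_zero_of_subsingleton [FiniteDimensional ℚ V] [Subsingleton V] (H : MixedHodgeStructure V)
    (S : MixedHodgeStructure U) : H.multiplicity S = 0 := by
  have h := multiplicity_le_length H S
  rw [length_eq_zero_iff.2 inferInstance] at h
  exact Nat.le_zero.1 h

/-- Restriction does not change multiplicities: for `T ⊆ T'`, `[T ∩ T' ⊆ T' : S] = [T : S]`.
[cite: CattaniElZeinGriffithsLe2014, Lemma 3.2.20] -/
theorem SubMixedHodgeStructure.multiplicity_comap_subtype [FiniteDimensional ℚ V] {T T' : SubMixedHodgeStructure H}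
    (h : T.toSubmodule ≤ T'.toSubmodule) (S : MixedHodgeStructure U) :
    (T.comap T'.subtype).toMixedHodgeStructure.multiplicity S = T.toMixedHodgeStructure.multiplicity S := by
  have e : T'.ofSub (T.comap T'.subtype) = T :=
    SubMixedHodgeStructure.ext (show (T.toSubmodule.comap T'.toSubmodule.subtype).map T'.toSubmodule.subtype = T.toSubmodule by
      rw [Submodule.map_comap_subtype, inf_eq_right.2 h])
  rw [← T'.multiplicity_ofSub (T.comap T'.subtype) S]
  exact congrArg (fun R : SubMixedHodgeStructure H => R.toMixedHodgeStructure.multiplicity S) e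

/-- One step of the weight filtration: **`[W_k H : S] = [W_{k-1} H : S] + [Gr^W_k H : S]`.**
[cite: Beachy1999RingsModules, §2.5, Thm. 2.5.2] [cite: CattaniElZeinGriffithsLe2014, Def. 3.2.15] -/
theorem multiplicity_weight_eq_add_multiplicity_gr [FiniteDimensional ℚ V] (H : MixedHodgeStructure V) (k : ℤ)
    (S : MixedHodgeStructure U) :
    (weight H k).toMixedHodgeStructure.multiplicity S =
      (weight H (k - 1)).toMixedHodgeStructure.multiplicity S + (H.gr k).toMixedHodgeStructure.multiplicity S := by
  rw [gr_toMixedHodgeStructure_eq_quotient, ← (weightPred H k).multiplicity_add S]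
  congr 1
  exact multiplicity_comap_subtype (H.monotone_W (by omega)) S

/-- Telescoping: `[W_{a+n} H : S] = [W_a H : S] + Σ_{k ∈ (a, a+n]} [Gr^W_k H : S]`.
[cite: Beachy1999RingsModules, §2.5, Thm. 2.5.2] [cite: CattaniElZeinGriffithsLe2014, Def. 3.2.15] -/
theorem multiplicity_weight_add_eq [FiniteDimensional ℚ V] (H : MixedHodgeStructure V) (a : ℤ) (n : ℕ) (S : MixedHodgeStructure U) :
    (weight H (a + n)).toMixedHodgeStructure.multiplicity S =
      (weight H a).toMixedHodgeStructure.multiplicity S +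
        ∑ k ∈ Finset.Ioc a (a + n), (H.gr k).toMixedHodgeStructure.multiplicity S := by
  induction n with
  | zero => rw [Nat.cast_zero, add_zero, Finset.Ioc_self, Finset.sum_empty, add_zero]
  | succ n ih =>
    have hstep := multiplicity_weight_eq_add_multiplicity_gr H (a + (n + 1 : ℕ)) S
    rw [show a + ((n + 1 : ℕ) : ℤ) - 1 = a + n by push_cast; ring] at hstep
    rw [hstep, ih, add_assoc, show a + ((n + 1 : ℕ) : ℤ) = a + n + 1 by push_cast; ring,
      ← Finset.insert_Ioc_right_eq_Ioc_add_one (show a ≤ a + n by omega), Finset.sum_insert (by simp), add_comm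
        ((H.gr (a + n + 1)).toMixedHodgeStructure.multiplicity S)]

/-- **`[H : S] = Σ_{a < k ≤ b} [Gr^W_k H : S]` whenever `W_a H = 0` and `W_b H = V`**: the composition factors
of `H` are those of its graded pieces. [cite: Beachy1999RingsModules, §2.5, Thm. 2.5.2] [cite: CattaniElZeinGriffithsLe2014, Def. 3.2.15 and Thm. 3.2.18] -/
theorem multiplicity_eq_sum_multiplicity_gr [FiniteDimensional ℚ V] (H : MixedHodgeStructure V) {a b : ℤ} (ha : H.W a = ⊥)
    (hb : H.W b = ⊤) (S : MixedHodgeStructure U) :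
    H.multiplicity S = ∑ k ∈ Finset.Ioc a b, (H.gr k).toMixedHodgeStructure.multiplicity S := by
  have hbot : (weight H a).toMixedHodgeStructure.multiplicity S = 0 := by
    haveI : Subsingleton (weight H a).toSubmodule := by rw [weight_toSubmodule, ha]; infer_instance
    exact multiplicity_eq_zero_of_subsingleton _ S
  have htop : (weight H b).toMixedHodgeStructure.multiplicity S = H.multiplicity S := by
    have hsub : Function.Bijective (weight H b).subtype.toLinearMap := by
      refine ⟨Submodule.injective_subtype _, ?_⟩
      rw [← LinearMap.range_eq_top]
      exact (Submodule.range_subtype _).trans hb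
    exact multiplicity_eq_of_bijective _ hsub S
  rcases le_or_gt a b with hab | hab
  · obtain ⟨n, rfl⟩ := Int.le.dest hab
    rw [← htop, multiplicity_weight_add_eq, hbot, zero_add]
  · have hV : (⊤ : Submodule ℚ V) = ⊥ := by
      rw [← hb, eq_bot_iff, ← ha]
      exact H.monotone_W hab.le
    haveI : Subsingleton V := subsingleton_of_forall_eq 0 fun v => (Submodule.mem_bot ℚ).1 (hV ▸ Submodule.mem_top)
    rw [Finset.Ioc_eq_empty (not_lt.2 hab.le), Finset.sum_empty]
    exact multiplicity_eq_zero_of_subsingleton H S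

/-- `[Gr^W_k H : S] = 0` for `S` pure of weight `m ≠ k`. [cite: CattaniElZeinGriffithsLe2014, Def. 3.2.15 and Ex. 3.2.23 (1)] -/
theorem multiplicity_gr_eq_zero_of_ne [FiniteDimensional ℚ V] [Nontrivial U] (H : MixedHodgeStructure V) {k m : ℤ}
    (hS : S.IsPure m) (hkm : k ≠ m) : (H.gr k).toMixedHodgeStructure.multiplicity S = 0 :=
  (HodgeStructure.isPure_toMixedHodgeStructure (H.gr k)).multiplicity_eq_zero_of_ne hS hkm

/-- `[Gr^W_k H : S] = 0` when `W_k H = 0`. [cite: CattaniElZeinGriffithsLe2014, Def. 3.2.15] -/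
theorem multiplicity_gr_eq_zero_of_W_eq_bot [FiniteDimensional ℚ V] (H : MixedHodgeStructure V) {k : ℤ} (hk : H.W k = ⊥)
    (S : MixedHodgeStructure U) : (H.gr k).toMixedHodgeStructure.multiplicity S = 0 := by
  have h := multiplicity_weight_eq_add_multiplicity_gr H k S
  haveI : Subsingleton (weight H k).toSubmodule := by rw [weight_toSubmodule, hk]; infer_instance
  rw [multiplicity_eq_zero_of_subsingleton _ S] at h
  omega

/-- `[Gr^W_k H : S] = 0` when `W_{k-1} H = V`. [cite: CattaniElZeinGriffithsLe2014, Def. 3.2.15] -/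
theorem multiplicity_gr_eq_zero_of_W_pred_eq_top [FiniteDimensional ℚ V] (H : MixedHodgeStructure V) {k : ℤ}
    (hk : H.W (k - 1) = ⊤) (S : MixedHodgeStructure U) : (H.gr k).toMixedHodgeStructure.multiplicity S = 0 := by
  have hk' : H.W k = ⊤ := eq_top_iff.2 (hk.ge.trans (H.monotone_W (show k - 1 ≤ k by omega)))
  have h := multiplicity_weight_eq_add_multiplicity_gr H k S
  have e₁ : Function.Bijective (weight H k).subtype.toLinearMap :=
    ⟨Submodule.injective_subtype _, by rw [← LinearMap.range_eq_top]; exact (Submodule.range_subtype _).trans hk'⟩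
  have e₂ : Function.Bijective (weight H (k - 1)).subtype.toLinearMap :=
    ⟨Submodule.injective_subtype _, by rw [← LinearMap.range_eq_top]; exact (Submodule.range_subtype _).trans hk⟩
  rw [multiplicity_eq_of_bijective _ e₁ S, multiplicity_eq_of_bijective _ e₂ S] at h
  omega

/-- **`[H : S] = Σ_k [Gr^W_k H : S]`** (a finite sum). [cite: Beachy1999RingsModules, §2.5, Thm. 2.5.2]
[cite: CattaniElZeinGriffithsLe2014, Def. 3.2.15 and Thm. 3.2.18] -/
theorem multiplicity_eq_finsum_multiplicity_gr [FiniteDimensional ℚ V] (H : MixedHodgeStructure V) (S : MixedHodgeStructure U) :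
    H.multiplicity S = ∑ᶠ k, (H.gr k).toMixedHodgeStructure.multiplicity S := by
  obtain ⟨a, ha⟩ := H.exists_W_eq_bot
  obtain ⟨b, hb⟩ := H.exists_W_eq_top
  rw [multiplicity_eq_sum_multiplicity_gr H ha hb, eq_comm]
  refine finsum_eq_sum_of_support_subset _ fun k hk => ?_
  rw [Function.mem_support] at hk
  rw [Finset.coe_Ioc, Set.mem_Ioc]
  constructor
  · by_contra hka
    exact hk (multiplicity_gr_eq_zero_of_W_eq_bot H (eq_bot_iff.2 (ha ▸ H.monotone_W (not_lt.1 hka))) S)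
  · by_contra hkb
    exact hk (multiplicity_gr_eq_zero_of_W_pred_eq_top H (eq_top_iff.2 (hb ▸ H.monotone_W (by omega))) S)

/-- **The multiplicity of a pure `S` of weight `m` in `H` is its multiplicity in the single graded piece
`Gr^W_m H`: `[H : S] = [Gr^W_m H : S]`.** [cite: Beachy1999RingsModules, §2.5, Thm. 2.5.2]
[cite: CattaniElZeinGriffithsLe2014, Def. 3.2.15, Thm. 3.2.18 and Ex. 3.2.23 (1)] -/
theorem multiplicity_eq_multiplicity_gr [FiniteDimensional ℚ V] [Nontrivial U] (H : MixedHodgeStructure V) {m : ℤ}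
    (hS : S.IsPure m) : H.multiplicity S = (H.gr m).toMixedHodgeStructure.multiplicity S := by
  rw [multiplicity_eq_finsum_multiplicity_gr]
  exact finsum_eq_single _ m fun k hk => multiplicity_gr_eq_zero_of_ne H hS hk

/-- In particular for a simple `S` (which is pure of some weight `m`): `[H : S] = [Gr^W_m H : S]`.
[cite: CattaniElZeinGriffithsLe2014, p. 270 and Def. 3.2.15] -/
theorem IsSimple.exists_multiplicity_eq_multiplicity_gr [FiniteDimensional ℚ V] (hS : S.IsSimple) (H : MixedHodgeStructure V)
    [FiniteDimensional ℚ U] : ∃ m : ℤ, S.IsPure m ∧ H.multiplicity S = (H.gr m).toMixedHodgeStructure.multiplicity S := by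
  haveI := hS.nontrivial
  obtain ⟨m, hm⟩ := hS.exists_isPure
  exact ⟨m, hm, multiplicity_eq_multiplicity_gr H hm⟩

/-- **A graded piece with a composition factor is non-zero**: `[Gr^W_m H : S] > 0 ⟹ m` is a weight of `H`.
[cite: CattaniElZeinGriffithsLe2014, Def. 3.2.15] -/
theorem isWeight_of_multiplicity_gr_pos [FiniteDimensional ℚ V] {m : ℤ}
    (h : 0 < (H.gr m).toMixedHodgeStructure.multiplicity S) : H.IsWeight m := by
  refine lt_of_le_of_ne (H.monotone_W (by omega)) fun heq => ?_
  rw [gr_toMixedHodgeStructure_eq_quotient] at h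
  have htop : subPiece H.W m = ⊤ := by
    show Submodule.comap (H.W m).subtype (H.W (m - 1)) = ⊤
    exact Submodule.comap_subtype_eq_top.2 heq.symm.le
  haveI : Subsingleton (grW H.W m) := Submodule.Quotient.subsingleton_iff.2 htop
  rw [multiplicity_eq_zero_of_subsingleton] at h
  exact lt_irrefl 0 h

/-- **The weight of a composition factor is a weight of `H`**: if `S` is pure of weight `m` and `[H : S] > 0`
then `Gr^W_m H ≠ 0`. [cite: CattaniElZeinGriffithsLe2014, Def. 3.2.15 and Ex. 3.2.23 (1)] -/
theorem isWeight_of_multiplicity_pos [FiniteDimensional ℚ V] [Nontrivial U] {m : ℤ} (hS : S.IsPure m)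
    (h : 0 < H.multiplicity S) : H.IsWeight m := by
  rw [multiplicity_eq_multiplicity_gr H hS] at h
  exact isWeight_of_multiplicity_gr_pos h

/-! ### §3 Direct sums and exact sequences -/

/-- **`[S ⊔ T : X] = [S : X] + [T : X]` for sub-MHS with `S ∩ T = 0`.** [cite: Beachy1999RingsModules, §2.5, Thm. 2.5.2]
[cite: CattaniElZeinGriffithsLe2014, Thm. 3.2.18] -/
theorem SubMixedHodgeStructure.multiplicity_sup_of_disjoint [FiniteDimensional ℚ V] (A B : SubMixedHodgeStructure H)
    (h : Disjoint A.toSubmodule B.toSubmodule) (S : MixedHodgeStructure U) :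
    (A.sup B).toMixedHodgeStructure.multiplicity S =
      A.toMixedHodgeStructure.multiplicity S + B.toMixedHodgeStructure.multiplicity S := by
  rw [← (A.comap (A.sup B).subtype).multiplicity_add S,
    multiplicity_comap_subtype (show A.toSubmodule ≤ (A.sup B).toSubmodule from le_sup_left)]
  congr 1
  obtain ⟨e, he⟩ := subquotientIso_sup_inf A B
  rw [multiplicity_eq_of_bijective e he]
  have hbot : ((A.inf B).comap B.subtype).toSubmodule = ⊥ := by
    rw [comap_toSubmodule, inf_toSubmodule, h.eq_bot, Submodule.comap_bot]
    exact Submodule.ker_subtype _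
  have h' := ((A.inf B).comap B.subtype).multiplicity_add S
  haveI : Subsingleton ((A.inf B).comap B.subtype).toSubmodule := by rw [hbot]; infer_instance
  rwa [multiplicity_eq_zero_of_subsingleton _ S, zero_add] at h'

/-- **`[H : X] = [S : X] + [T : X]` for complementary sub-MHS `H = S ⊕ T`.** [cite: Beachy1999RingsModules, §2.5, Thm. 2.5.2] -/
theorem multiplicity_eq_add_of_isCompl [FiniteDimensional ℚ V] (A B : SubMixedHodgeStructure H)
    (h : IsCompl A.toSubmodule B.toSubmodule) (S : MixedHodgeStructure U) :
    H.multiplicity S = A.toMixedHodgeStructure.multiplicity S + B.toMixedHodgeStructure.multiplicity S := by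
  rw [← A.multiplicity_sup_of_disjoint B h.disjoint S]
  have hsub : Function.Bijective (A.sup B).subtype.toLinearMap := by
    refine ⟨Submodule.injective_subtype _, ?_⟩
    rw [← LinearMap.range_eq_top]
    exact (Submodule.range_subtype _).trans h.sup_eq_top
  exact (multiplicity_eq_of_bijective _ hsub S).symm

/-- **`[⊕_{i ∈ s} Sᵢ : X] = Σ_{i ∈ s} [Sᵢ : X]` for an independent family of sub-MHS.**
[cite: Beachy1999RingsModules, §2.5, Thm. 2.5.2] [cite: CattaniElZeinGriffithsLe2014, Thm. 3.2.18] -/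
theorem SubMixedHodgeStructure.multiplicity_biSup_of_iSupIndep [FiniteDimensional ℚ V] {ι : Type*} (T : ι → SubMixedHodgeStructure H)
    (hT : iSupIndep fun i => (T i).toSubmodule) (s : Finset ι) (S : MixedHodgeStructure U) :
    (SubMixedHodgeStructure.iSup fun i => SubMixedHodgeStructure.iSup fun _ : i ∈ s => T i).toMixedHodgeStructure.multiplicity S =
      ∑ i ∈ s, (T i).toMixedHodgeStructure.multiplicity S := by
  classical
  induction s using Finset.induction_on with
  | empty =>
    rw [Finset.sum_empty]
    haveI : Subsingleton (SubMixedHodgeStructure.iSup fun i => SubMixedHodgeStructure.iSup fun _ : i ∈ (∅ : Finset ι) => T i).toSubmodule := by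
      rw [iSup_toSubmodule]
      simp only [iSup_toSubmodule, Finset.notMem_empty, iSup_false, iSup_bot]
      infer_instance
    exact multiplicity_eq_zero_of_subsingleton _ S
  | insert j s hj ih =>
    have e : (SubMixedHodgeStructure.iSup fun i => SubMixedHodgeStructure.iSup fun _ : i ∈ insert j s => T i) =
        (T j).sup (SubMixedHodgeStructure.iSup fun i => SubMixedHodgeStructure.iSup fun _ : i ∈ s => T i) :=
      SubMixedHodgeStructure.ext (by
        simp only [iSup_toSubmodule, sup_toSubmodule]
        exact Finset.iSup_insert j s fun i => (T i).toSubmodule)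
    rw [e, multiplicity_sup_of_disjoint _ _ ?_, ih, Finset.sum_insert hj]
    simp only [iSup_toSubmodule]
    exact hT.disjoint_biSup (y := (s : Set ι)) (by exact_mod_cast hj)

/-- **`[H : X] = Σᵢ [Sᵢ : X]` for an internal direct sum decomposition `H = ⊕ᵢ Sᵢ` into sub-MHS.**
[cite: Beachy1999RingsModules, §2.5, Thm. 2.5.2] [cite: CattaniElZeinGriffithsLe2014, Thm. 3.2.18] -/
theorem multiplicity_eq_sum_of_iSupIndep_of_iSup_eq_top [FiniteDimensional ℚ V] {ι : Type*} [Fintype ι]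
    (T : ι → SubMixedHodgeStructure H) (hT : iSupIndep fun i => (T i).toSubmodule)
    (htop : ⨆ i, (T i).toSubmodule = ⊤) (S : MixedHodgeStructure U) :
    H.multiplicity S = ∑ i, (T i).toMixedHodgeStructure.multiplicity S := by
  rw [← multiplicity_biSup_of_iSupIndep T hT Finset.univ S]
  have htop' : (SubMixedHodgeStructure.iSup fun i => SubMixedHodgeStructure.iSup fun _ : i ∈ (Finset.univ : Finset ι) => T i).toSubmodule = ⊤ := by
    simp only [iSup_toSubmodule, Finset.mem_univ, iSup_pos]
    exact htop
  have hsub : Function.Bijective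
      (SubMixedHodgeStructure.iSup fun i => SubMixedHodgeStructure.iSup fun _ : i ∈ (Finset.univ : Finset ι) => T i).subtype.toLinearMap := by
    refine ⟨Submodule.injective_subtype _, ?_⟩
    rw [← LinearMap.range_eq_top]
    exact (Submodule.range_subtype _).trans htop'
  exact (multiplicity_eq_of_bijective _ hsub S).symm

open scoped Classical in
/-- **For a decomposition `H = ⊕ᵢ Sᵢ` into SIMPLE sub-MHS, `[H : S]` is the number of summands isomorphic to
`S`** — the Jordan–Hölder multiplicity agrees with the Krull–Schmidt count. [cite: Beachy1999RingsModules, §2.5, Def. 2.5.1 and Thm. 2.5.2]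
[cite: CattaniElZeinGriffithsLe2014, p. 270] -/
theorem multiplicity_eq_card_filter_of_isSimple [FiniteDimensional ℚ V] {ι : Type*} [Fintype ι]
    (T : ι → SubMixedHodgeStructure H) (hT : iSupIndep fun i => (T i).toSubmodule) (htop : ⨆ i, (T i).toSubmodule = ⊤)
    (hsimple : ∀ i, (T i).toMixedHodgeStructure.IsSimple) (S : MixedHodgeStructure U) :
    H.multiplicity S =
      (Finset.univ.filter fun i => ∃ e : Hom (T i).toMixedHodgeStructure S, Function.Bijective e.toLinearMap).card := by
  rw [multiplicity_eq_sum_of_iSupIndep_of_iSup_eq_top T hT htop S, Finset.card_filter]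
  exact Finset.sum_congr rfl fun i _ => (hsimple i).multiplicity_eq S

section Prod

variable {V₂ : Type v} [AddCommGroup V₂] [Module ℚ V₂]

/-- **`[H₁ ⊕ H₂ : S] = [H₁ : S] + [H₂ : S].`** [cite: Beachy1999RingsModules, §2.5, Thm. 2.5.2] [cite: CattaniElZeinGriffithsLe2014, Thm. 3.2.18] -/
theorem multiplicity_prod [FiniteDimensional ℚ V] [FiniteDimensional ℚ V₂] (H₁ : MixedHodgeStructure V)
    (H₂ : MixedHodgeStructure V₂) (S : MixedHodgeStructure U) :
    (H₁.prod H₂).multiplicity S = H₁.multiplicity S + H₂.multiplicity S := by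
  rw [multiplicity_eq_add_of_isCompl _ _ (isCompl_range_inl_range_inr H₁ H₂),
    ← multiplicity_eq_of_bijective _ ((Hom.inl H₁ H₂).rangeRestrict_bijective_of_injective LinearMap.inl_injective),
    ← multiplicity_eq_of_bijective _ ((Hom.inr H₁ H₂).rangeRestrict_bijective_of_injective LinearMap.inr_injective)]

end Prod

/-- **Rank–nullity for multiplicities: `[Ker f : S] + [Im f : S] = [H : S]`.** [cite: Beachy1999RingsModules, §2.5, Thm. 2.5.2]
[cite: CattaniElZeinGriffithsLe2014, Thm. 3.2.18] -/
theorem Hom.multiplicity_ker_add_multiplicity_range [FiniteDimensional ℚ V] [FiniteDimensional ℚ V'] (f : Hom H H')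
    (S : MixedHodgeStructure U) :
    f.ker.toMixedHodgeStructure.multiplicity S + f.range.toMixedHodgeStructure.multiplicity S = H.multiplicity S := by
  rw [← multiplicity_eq_of_bijective f.coimageToRange f.coimageToRange_bijective S]
  exact f.ker.multiplicity_add S

/-- **Multiplicities are additive on short exact sequences**: `Im i = Ker p`, `i` injective, `p` surjective give
`[H' : S] = [H : S] + [H'' : S]`. [cite: Beachy1999RingsModules, §2.5, Thm. 2.5.2] [cite: CattaniElZeinGriffithsLe2014, Thm. 3.2.18] -/
theorem multiplicity_eq_add_of_exact {V'' : Type w} [AddCommGroup V''] [Module ℚ V''] {H'' : MixedHodgeStructure V''}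
    [FiniteDimensional ℚ V] [FiniteDimensional ℚ V'] [FiniteDimensional ℚ V'']
    (i : Hom H H') (p : Hom H' H'') (hi : Function.Injective i.toLinearMap) (hp : Function.Surjective p.toLinearMap)
    (h : Function.Exact i.toLinearMap p.toLinearMap) (S : MixedHodgeStructure U) :
    H'.multiplicity S = H.multiplicity S + H''.multiplicity S := by
  have hker : p.ker = i.range :=
    SubMixedHodgeStructure.ext (by rw [Hom.ker_toSubmodule, Hom.range_toSubmodule]; exact (LinearMap.exact_iff.1 h))
  have htop : Function.Bijective p.range.subtype.toLinearMap := by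
    refine ⟨Submodule.injective_subtype _, ?_⟩
    rw [← LinearMap.range_eq_top]
    exact (Submodule.range_subtype _).trans (by rw [Hom.range_toSubmodule]; exact LinearMap.range_eq_top.2 hp)
  rw [← p.multiplicity_ker_add_multiplicity_range S, hker,
    ← multiplicity_eq_of_bijective i.rangeRestrict (i.rangeRestrict_bijective_of_injective hi) S,
    multiplicity_eq_of_bijective _ htop S]

/-- **`[E : S] = [B : S] + [A : S]` for an extension `0 → B → E → A → 0`.** [cite: Beachy1999RingsModules, §2.5, Thm. 2.5.2] -/
theorem Extension.multiplicity_eq {VA : Type u} [AddCommGroup VA] [Module ℚ VA] [FiniteDimensional ℚ VA]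
    {VB : Type v} [AddCommGroup VB] [Module ℚ VB] [FiniteDimensional ℚ VB]
    {VE : Type w} [AddCommGroup VE] [Module ℚ VE] [FiniteDimensional ℚ VE]
    {U' : Type u} [AddCommGroup U'] [Module ℚ U']
    {A : MixedHodgeStructure VA} {B : MixedHodgeStructure VB} (E : Extension A B VE) (S : MixedHodgeStructure U') :
    E.mhs.multiplicity S = B.multiplicity S + A.multiplicity S :=
  multiplicity_eq_add_of_exact E.inc E.proj E.injective_inc E.surjective_proj E.exact S

end MixedHodgeStructure

end Literature.AlgebraicGeometry.Motives
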